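import Summits.QuantumFields.BalabanUV.Beta.GAN24.AveragedPropagatorTwoLevel
import Summits.QuantumFields.BalabanUV.Beta.GAN24.StaircaseLaplacianDefectVec
import Summits.QuantumFields.BalabanUV.Beta.GAN24.StaircaseGradDivDefect

/-!
# G-an2-4 ∕ (CONV-C), road P2, route R2-S1, VECTOR LAYER, PART 4 — THE LOCAL DEFECT FIELDS OF THE AVERAGED-PROPAGATOR IDENTITY IN
# VECTOR-LETTER-READY FORM: `(Lap′(J⊗1) − (J⊗1)Lap)u` and `(∂′∂′ᴴ(J⊗1) − (J⊗1)∂∂ᴴ)u` as sums of `∇′ᴴ∇′ᴴ(·)`, `∇′ᴴ(·)`, `∇′∇′ᴴ(·)` of explicit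
# fields of size `≤ ((R−1)∕(RN))·(|∇u|, |∇∇u|)`, plus the shift∕commutation sup-norm transfers `∇_ν = −τ∇_νᴴ`

Unit `b2b-balaban-gan24-p2` (gen 30), BINDER row G-an2-4 ∕ (CONV-C), road P2; crux team (2).  Part 3 (`AveragedPropagatorTwoLevel.covOp_succ_sub`)
reduces `c_{RN} − c_N` (`c = Q𝒢Q*`) to `Q′𝒢′E₂ + E₁𝒢Q* − Q′𝒢′·𝔇·𝒢Q*` with the LOCAL defect `𝔇 = (Lap′J − JLap) − (∂′∂′ᴴJ − J∂∂ᴴ) + a(E₂Q + Q′*E₁)`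
(`J = stairV`).  The tree's bricks give `𝔇` POINTWISE on component slices (`StaircaseLaplacianDefectVec.Lap_stairV_defect`,
`StaircaseGradDivDefect.GradOp_stair_defect ∕ GradOpH_stairV_defect`, scalar `sdiff` on `fun y ↦ u (y, μ)`); the VECTOR sup letters of `𝒢`
(`Entry115SupCubic`, `Entry112SupLogCubicFlat`) speak `fdiff` on `Tor × Fin d`.  THIS FILE is the dictionary between the two:
 * §1 generic level (`Nf`, lattice factor `m : ℕ`): **`fdiffH_apply_eq_neg_fdiff`** (`(∇_νᴴF)(x) = −(∇_νF)(x − e_ν)`), **`fdiff_fdiffH_comm`**,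
   **`fdiff_fdiffH_eq_shift`** (`∇_μ∇_νᴴF = ∇_μᴴ∇_νᴴ(−τ_μF)`), and the sup-norm transfers `norm_fdiffH_le_of_fdiff`, `norm_fdiffH_fdiff_le`,
   `norm_fdiff_fdiffH_le`, `norm_shiftM_mulVec_le`; the component embedding **`emb μ φ`** (`(x,κ) ↦ [κ = μ]·φ(x)`) with `fdiff_emb`,
   `fdiffH_emb`, `sum_emb_apply`, `norm_emb_le`;
 * §2 two levels (`N R M`, fine field `u` at level `N`): the fields **`PhiL`**, **`PsiF`** (Laplacian defect), **`phiF`**, **`phiLdiv`** (grad-div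
   defect) and the identities **`Lap_defect_mulVec`**:
   `(Lap′J − JLap)u = Σ_ν ∇′_νᴴ(∇′_νᴴ(PhiL ν u) + PsiF ν u)`, **`gradDiv_defect_mulVec`**:
   `(∂′∂′ᴴJ − J∂∂ᴴ)u = Σ_ν Σ_μ ∇′_μ∇′_νᴴ(emb μ (phiF ν u)) + Σ_μ ∇′_μᴴ(emb μ (phiLdiv μ u))`;
 * §3 their sizes: `|PhiL ν u| ≤ ρ·sup|∇_νu|`, `|PsiF ν u| ≤ ρ·sup|∇_ν∇_νu|`, `|phiF ν u| ≤ ρ·sup|∇_νu|`, `|phiLdiv μ u| ≤ ρ·d·sup_{μ′ν′}|∇_{μ′}∇_{ν′}u|`,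
   `ρ = (R−1)∕(RN)` (`norm_piL_le`∕`norm_piF_le`).
HONEST SCOPE.  Finite-lattice calculus at `U = 1`, every `d`, `N, R ≥ 1`, every torus; [folklore], kernel-checked, no `sorry`, no `def … : Prop`;
the mathematics is gen 29's bricks BY NAME.  NOT (CONV-C), NEVER «G-an2-4 closed», NOT NE2, NOT D1, NOT BetaPertH, NOT continuum, NOT Clay; not in
print — our bookkeeping.  HONEST DEPENDENCY: continuum YM on T⁴ ⇐ BetaPertH ∧ nine spine estimates (0/9 proved); BetaPertH ⇐ (D1) ∧ (D4) ∧
CAP+tail; G-an2-4 gates asym, D1 and NE2/3/4.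
-/

noncomputable section

open scoped BigOperators ComplexConjugate Matrix

namespace Summit.QuantumFields.BalabanUV.Beta.GAN24.AveragedPropagatorDefectFields

open Literature.MathematicalPhysics.QuantumFieldTheory.Balaban1983to89
open B5Prop11Plancherel (Tor fine unitVec fdiff shiftM)
open B5Prop11Lower (Lap)
open B5Action121 (sdiff GradOp comp divS GradOp_mulVec GradOp_conjTranspose_mulVec sdiff_mulVec sdiff_conjTranspose_mulVec)
open B5G183FreeRowSum (fdiff_mulVec fdiff_conjTranspose_mulVec shiftM_mulVec)
open Summit.QuantumFields.BalabanUV.T4Continuum.BalabanAveragedTowerModes (par)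
open Summit.QuantumFields.BalabanUV.Beta.GAN24.StaircaseLaplacianDefect (stair stair_mulVec piL piF norm_piL_le norm_piF_le)
open Summit.QuantumFields.BalabanUV.Beta.GAN24.StaircaseLaplacianDefectVec (fdiff_mulVec_slice fdiffH_mulVec_slice Lap_stairV_defect)
open Summit.QuantumFields.BalabanUV.Beta.GAN24.StaircaseGradDivDefect (GradOp_stair_defect GradOpH_stairV_defect)
open Summit.QuantumFields.BalabanUV.Beta.GAN24.StaircaseAveragingDefect (stairV stairV_mulVec stairV_mulVec_eq ratio_nonneg)

variable {d : ℕ}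

/-! ## §1 Generic level: shifts, commutation, component embedding -/

section Generic

variable {Nf : Fin d → ℕ} [∀ μ, NeZero (Nf μ)] (m : ℕ)

/-- `(∇_νᴴF)(x, κ) = −(∇_νF)(x − e_ν, κ)` (real lattice factor). [folklore] -/
theorem fdiffH_apply_eq_neg_fdiff (ν : Fin d) (F : Tor Nf × Fin d → ℂ) (x : Tor Nf) (κ : Fin d) :
    ((fdiff Nf (m : ℂ) ν)ᴴ *ᵥ F) (x, κ) = -((fdiff Nf (m : ℂ) ν *ᵥ F) (x - unitVec Nf ν, κ)) := by
  rw [fdiff_conjTranspose_mulVec, fdiff_mulVec, Complex.conj_natCast, sub_add_cancel]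
  ring

/-- sup-norm transfer `|∇_νᴴF| ≤ sup|∇_νF|`. [folklore] -/
theorem norm_fdiffH_le_of_fdiff (ν : Fin d) (F : Tor Nf × Fin d → ℂ) {B : ℝ} (h : ∀ i, ‖(fdiff Nf (m : ℂ) ν *ᵥ F) i‖ ≤ B)
    (i : Tor Nf × Fin d) : ‖((fdiff Nf (m : ℂ) ν)ᴴ *ᵥ F) i‖ ≤ B := by
  obtain ⟨x, κ⟩ := i
  rw [fdiffH_apply_eq_neg_fdiff, norm_neg]
  exact h _

/-- `∇_μ∇_νᴴ = ∇_νᴴ∇_μ` (commuting shifts). [folklore] -/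
theorem fdiff_fdiffH_comm (c : ℂ) (μ ν : Fin d) (F : Tor Nf × Fin d → ℂ) :
    fdiff Nf c μ *ᵥ ((fdiff Nf c ν)ᴴ *ᵥ F) = (fdiff Nf c ν)ᴴ *ᵥ (fdiff Nf c μ *ᵥ F) := by
  funext i
  obtain ⟨x, κ⟩ := i
  simp only [fdiff_mulVec, fdiff_conjTranspose_mulVec]
  rw [show x + unitVec Nf μ - unitVec Nf ν = x - unitVec Nf ν + unitVec Nf μ from by abel]
  ring

/-- sup-norm transfer `|∇_νᴴ∇_νF| ≤ sup|∇_ν∇_νF|`. [folklore] -/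
theorem norm_fdiffH_fdiff_le (ν : Fin d) (F : Tor Nf × Fin d → ℂ) {B : ℝ}
    (h : ∀ i, ‖(fdiff Nf (m : ℂ) ν *ᵥ (fdiff Nf (m : ℂ) ν *ᵥ F)) i‖ ≤ B) (i : Tor Nf × Fin d) :
    ‖((fdiff Nf (m : ℂ) ν)ᴴ *ᵥ (fdiff Nf (m : ℂ) ν *ᵥ F)) i‖ ≤ B :=
  norm_fdiffH_le_of_fdiff m ν _ h i

/-- sup-norm transfer `|∇_μ∇_νᴴF| ≤ sup|∇_ν∇_μF|`. [folklore] -/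
theorem norm_fdiff_fdiffH_le (μ ν : Fin d) (F : Tor Nf × Fin d → ℂ) {B : ℝ}
    (h : ∀ i, ‖(fdiff Nf (m : ℂ) ν *ᵥ (fdiff Nf (m : ℂ) μ *ᵥ F)) i‖ ≤ B) (i : Tor Nf × Fin d) :
    ‖(fdiff Nf (m : ℂ) μ *ᵥ ((fdiff Nf (m : ℂ) ν)ᴴ *ᵥ F)) i‖ ≤ B := by
  rw [fdiff_fdiffH_comm]
  exact norm_fdiffH_le_of_fdiff m ν _ h i

/-- `∇_μ∇_νᴴF = ∇_μᴴ∇_νᴴ(−τ_μF)`, `(τ_μF)(x,κ) = F(x + e_μ, κ)` — moves a mixed second difference onto the `∇ᴴ∇ᴴ` letter. [folklore] -/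
theorem fdiff_fdiffH_eq_shift (μ ν : Fin d) (F : Tor Nf × Fin d → ℂ) :
    fdiff Nf (m : ℂ) μ *ᵥ ((fdiff Nf (m : ℂ) ν)ᴴ *ᵥ F)
      = (fdiff Nf (m : ℂ) μ)ᴴ *ᵥ ((fdiff Nf (m : ℂ) ν)ᴴ *ᵥ (-(shiftM Nf μ *ᵥ F))) := by
  funext i
  obtain ⟨x, κ⟩ := i
  simp only [fdiff_mulVec, fdiff_conjTranspose_mulVec, Pi.neg_apply, shiftM_mulVec, Complex.conj_natCast]
  rw [show x - unitVec Nf μ - unitVec Nf ν + unitVec Nf μ = x - unitVec Nf ν from by abel,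
    show x + unitVec Nf μ - unitVec Nf ν = x - unitVec Nf ν + unitVec Nf μ from by abel, sub_add_cancel]
  ring

/-- `|τ_μF| ≤ sup|F|`, `|−τ_μF| ≤ sup|F|`. [folklore] -/
theorem norm_neg_shiftM_mulVec_le (μ : Fin d) (F : Tor Nf × Fin d → ℂ) {B : ℝ} (h : ∀ i, ‖F i‖ ≤ B) (i : Tor Nf × Fin d) :
    ‖(-(shiftM Nf μ *ᵥ F)) i‖ ≤ B := by
  rw [Pi.neg_apply, norm_neg, shiftM_mulVec]; exact h _

/-- **the component embedding** `emb μ φ (x, κ) = [κ = μ]·φ(x)` (a scalar field placed in component `μ`). [folklore] -/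
def emb (μ : Fin d) (φ : Tor Nf → ℂ) : Tor Nf × Fin d → ℂ := fun i => if i.2 = μ then φ i.1 else 0

omit [∀ μ, NeZero (Nf μ)] in
/-- `|emb μ φ| ≤ sup|φ|`. [folklore] -/
theorem norm_emb_le (μ : Fin d) (φ : Tor Nf → ℂ) {B : ℝ} (h : ∀ x, ‖φ x‖ ≤ B) (i : Tor Nf × Fin d) : ‖emb μ φ i‖ ≤ B := by
  unfold emb
  split_ifs
  · exact h _
  · rw [norm_zero]; exact (norm_nonneg _).trans (h i.1)

/-- `∇_ν(emb μ φ) = emb μ (∂_νφ)`. [folklore] -/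
theorem fdiff_emb (c : ℂ) (ν μ : Fin d) (φ : Tor Nf → ℂ) :
    fdiff Nf c ν *ᵥ emb μ φ = emb μ (sdiff Nf c ν *ᵥ φ) := by
  funext i
  obtain ⟨x, κ⟩ := i
  rw [fdiff_mulVec]
  unfold emb
  dsimp only
  split_ifs
  · rw [sdiff_mulVec]
  · ring

/-- `∇_νᴴ(emb μ φ) = emb μ (∂_νᴴφ)`. [folklore] -/
theorem fdiffH_emb (c : ℂ) (ν μ : Fin d) (φ : Tor Nf → ℂ) :
    (fdiff Nf c ν)ᴴ *ᵥ emb μ φ = emb μ ((sdiff Nf c ν)ᴴ *ᵥ φ) := by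
  funext i
  obtain ⟨x, κ⟩ := i
  rw [fdiff_conjTranspose_mulVec]
  unfold emb
  dsimp only
  split_ifs
  · rw [sdiff_conjTranspose_mulVec]
  · ring

omit [∀ μ, NeZero (Nf μ)] in
/-- `(Σ_μ emb μ (Φ μ))(x, κ) = Φ κ x`. [folklore] -/
theorem sum_emb_apply (Φ : Fin d → Tor Nf → ℂ) (i : Tor Nf × Fin d) : (∑ μ, emb μ (Φ μ)) i = Φ i.2 i.1 := by
  rw [Finset.sum_apply]
  unfold emb
  rw [Finset.sum_ite_eq Finset.univ i.2 (fun μ => Φ μ i.1), if_pos (Finset.mem_univ _)]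

end Generic


/-! ## §2 Two levels: the defect fields and the identities -/

section TwoLevel

variable (N R : ℕ) [NeZero N] [NeZero R] (M : Fin d → ℕ) [hM : ∀ μ, NeZero (M μ)]

/-- Laplacian defect, last-layer field: `PhiL ν u (x′, κ) = π^L_ν(x′)·(∇_νu)(par x′, κ)`. [folklore] -/
def PhiL (ν : Fin d) (u : Tor (fine N M) × Fin d → ℂ) : Tor (fine (R * N) M) × Fin d → ℂ :=
  fun i => piL N R M ν i.1 * (fdiff (fine N M) (N : ℂ) ν *ᵥ u) (par N R M i.1, i.2)

/-- Laplacian defect, first-layer field: `PsiF ν u (x′, κ) = π^F_ν(x′)·(∇_νᴴ∇_νu)(par x′, κ)`. [folklore] -/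
def PsiF (ν : Fin d) (u : Tor (fine N M) × Fin d → ℂ) : Tor (fine (R * N) M) × Fin d → ℂ :=
  fun i => piF N R M ν i.1 * ((fdiff (fine N M) (N : ℂ) ν)ᴴ *ᵥ (fdiff (fine N M) (N : ℂ) ν *ᵥ u)) (par N R M i.1, i.2)

/-- divergence defect field (scalar): `phiF ν u (x′) = π^F_ν(x′)·(∂_νᴴu_ν)(par x′)`. [folklore] -/
def phiF (ν : Fin d) (u : Tor (fine N M) × Fin d → ℂ) : Tor (fine (R * N) M) → ℂ :=
  fun z => piF N R M ν z * (stair N R M *ᵥ ((sdiff (fine N M) (N : ℂ) ν)ᴴ *ᵥ comp (fine N M) u ν)) z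

/-- gradient defect field on the divergence (scalar): `phiLdiv μ u (x′) = π^L_μ(x′)·(∂_μ(∂ᴴu))(par x′)`. [folklore] -/
def phiLdiv (μ : Fin d) (u : Tor (fine N M) × Fin d → ℂ) : Tor (fine (R * N) M) → ℂ :=
  fun z => piL N R M μ z * (stair N R M *ᵥ (sdiff (fine N M) (N : ℂ) μ *ᵥ ((GradOp (fine N M) (N : ℂ))ᴴ *ᵥ u))) z

/-- **THE LAPLACIAN DEFECT IN VECTOR FORM**: `((Lap′(J⊗1) − (J⊗1)Lap)u) = Σ_ν ∇′_νᴴ(∇′_νᴴ(PhiL ν u) + PsiF ν u)` — gen 29's `Lap_stairV_defect`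
re-read with the vector differences `fdiff`. [folklore] -/
theorem Lap_defect_mulVec (u : Tor (fine N M) × Fin d → ℂ) :
    (Lap (R * N) M * stairV N R M - stairV N R M * Lap N M) *ᵥ u
      = ∑ ν, (fdiff (fine (R * N) M) ((R * N : ℕ) : ℂ) ν)ᴴ *ᵥ
          ((fdiff (fine (R * N) M) ((R * N : ℕ) : ℂ) ν)ᴴ *ᵥ PhiL N R M ν u + PsiF N R M ν u) := by
  funext i
  obtain ⟨x, μ⟩ := i
  have hb := Lap_stairV_defect N R M u x μ
  rw [Matrix.sub_mulVec, Pi.sub_apply, ← Matrix.mulVec_mulVec, ← Matrix.mulVec_mulVec, stairV_mulVec_eq, stairV_mulVec]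
  dsimp only
  rw [hb, Finset.sum_apply, Finset.sum_apply]
  refine Finset.sum_congr rfl fun ν _ => ?_
  rw [fdiffH_mulVec_slice]
  congr 1
  funext y
  rw [Pi.add_apply, Pi.add_apply, fdiffH_mulVec_slice]
  congr 1
  · congr 1
    funext z
    simp only [PhiL, stair_mulVec, fdiff_mulVec_slice]
  · simp only [PsiF, stair_mulVec, fdiffH_mulVec_slice, StaircaseLaplacianDefectVec.slice_fdiff_mulVec]

/-- **THE GRAD-DIV DEFECT IN VECTOR FORM**:
`((∂′∂′ᴴ(J⊗1) − (J⊗1)∂∂ᴴ)u) = Σ_ν Σ_μ ∇′_μ∇′_νᴴ(emb μ (phiF ν u)) + Σ_μ ∇′_μᴴ(emb μ (phiLdiv μ u))` — gen 29's `GradOpH_stairV_defect` and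
`GradOp_stair_defect` re-read with `fdiff` and the component embedding. [folklore] -/
theorem gradDiv_defect_mulVec (u : Tor (fine N M) × Fin d → ℂ) :
    (GradOp (fine (R * N) M) ((R * N : ℕ) : ℂ) * (GradOp (fine (R * N) M) ((R * N : ℕ) : ℂ))ᴴ * stairV N R M
        - stairV N R M * (GradOp (fine N M) ((N : ℕ) : ℂ) * (GradOp (fine N M) ((N : ℕ) : ℂ))ᴴ)) *ᵥ u
      = (∑ ν, ∑ μ, fdiff (fine (R * N) M) ((R * N : ℕ) : ℂ) μ *ᵥ
            ((fdiff (fine (R * N) M) ((R * N : ℕ) : ℂ) ν)ᴴ *ᵥ emb μ (phiF N R M ν u)))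
        + ∑ μ, (fdiff (fine (R * N) M) ((R * N : ℕ) : ℂ) μ)ᴴ *ᵥ emb μ (phiLdiv N R M μ u) := by
  -- (i) the divergence of `(J⊗1)u` = staircase of the divergence + the first-layer defect (as functions)
  have hdiv : (GradOp (fine (R * N) M) ((R * N : ℕ) : ℂ))ᴴ *ᵥ (stairV N R M *ᵥ u)
      = stair N R M *ᵥ ((GradOp (fine N M) ((N : ℕ) : ℂ))ᴴ *ᵥ u)
        + ∑ ν, (sdiff (fine (R * N) M) ((R * N : ℕ) : ℂ) ν)ᴴ *ᵥ phiF N R M ν u := by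
    funext z
    have h := GradOpH_stairV_defect N R M u z
    rw [stairV_mulVec_eq, Pi.add_apply, Finset.sum_apply, stair_mulVec]
    unfold phiF
    exact sub_eq_iff_eq_add'.mp h
  -- (ii) the gradient of the staircase of the divergence
  have hgrad : GradOp (fine (R * N) M) ((R * N : ℕ) : ℂ) *ᵥ (stair N R M *ᵥ ((GradOp (fine N M) ((N : ℕ) : ℂ))ᴴ *ᵥ u))
        - stairV N R M *ᵥ (GradOp (fine N M) ((N : ℕ) : ℂ) *ᵥ ((GradOp (fine N M) ((N : ℕ) : ℂ))ᴴ *ᵥ u))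
      = ∑ μ, (fdiff (fine (R * N) M) ((R * N : ℕ) : ℂ) μ)ᴴ *ᵥ emb μ (phiLdiv N R M μ u) := by
    funext i
    obtain ⟨x, κ⟩ := i
    rw [Pi.sub_apply, stairV_mulVec]
    dsimp only
    rw [GradOp_stair_defect]
    have e : (∑ μ, (fdiff (fine (R * N) M) ((R * N : ℕ) : ℂ) μ)ᴴ *ᵥ emb μ (phiLdiv N R M μ u)) (x, κ)
        = (∑ μ, emb μ ((sdiff (fine (R * N) M) ((R * N : ℕ) : ℂ) μ)ᴴ *ᵥ phiLdiv N R M μ u)) (x, κ) := by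
      rw [Finset.sum_apply, Finset.sum_apply]
      exact Finset.sum_congr rfl fun μ _ => by rw [fdiffH_emb]
    rw [e, sum_emb_apply]
    rfl
  -- (iii) the gradient of a scalar `∂′_νᴴφ` in vector-letter form
  have hV : ∀ (ν : Fin d) (φ : Tor (fine (R * N) M) → ℂ),
      GradOp (fine (R * N) M) ((R * N : ℕ) : ℂ) *ᵥ ((sdiff (fine (R * N) M) ((R * N : ℕ) : ℂ) ν)ᴴ *ᵥ φ)
        = ∑ μ, fdiff (fine (R * N) M) ((R * N : ℕ) : ℂ) μ *ᵥ
            ((fdiff (fine (R * N) M) ((R * N : ℕ) : ℂ) ν)ᴴ *ᵥ emb μ φ) := by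
    intro ν φ
    funext i
    obtain ⟨x, κ⟩ := i
    have e : (∑ μ, fdiff (fine (R * N) M) ((R * N : ℕ) : ℂ) μ *ᵥ
          ((fdiff (fine (R * N) M) ((R * N : ℕ) : ℂ) ν)ᴴ *ᵥ emb μ φ)) (x, κ)
        = (∑ μ, emb μ (sdiff (fine (R * N) M) ((R * N : ℕ) : ℂ) μ *ᵥ
            ((sdiff (fine (R * N) M) ((R * N : ℕ) : ℂ) ν)ᴴ *ᵥ φ))) (x, κ) := by
      rw [Finset.sum_apply, Finset.sum_apply]
      exact Finset.sum_congr rfl fun μ _ => by rw [fdiffH_emb, fdiff_emb]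
    rw [GradOp_mulVec, e, sum_emb_apply]
  -- assembly
  simp only [Matrix.sub_mulVec, ← Matrix.mulVec_mulVec]
  rw [hdiv, Matrix.mulVec_add, Matrix.mulVec_sum]
  simp_rw [hV]
  rw [← hgrad]
  abel

/-! ## §3 Sizes of the defect fields -/

/-- `|PhiL ν u| ≤ ((R−1)∕(RN))·sup|∇_νu|`. [folklore] -/
theorem norm_PhiL_le (ν : Fin d) (u : Tor (fine N M) × Fin d → ℂ) {B : ℝ}
    (h : ∀ j, ‖(fdiff (fine N M) (N : ℂ) ν *ᵥ u) j‖ ≤ B) (i : Tor (fine (R * N) M) × Fin d) :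
    ‖PhiL N R M ν u i‖ ≤ (((R : ℝ) - 1) / ((R : ℝ) * N)) * B := by
  unfold PhiL
  rw [norm_mul]
  exact mul_le_mul (norm_piL_le N R M ν i.1) (h _) (norm_nonneg _) (ratio_nonneg N R)

/-- `|PsiF ν u| ≤ ((R−1)∕(RN))·sup|∇_ν∇_νu|`. [folklore] -/
theorem norm_PsiF_le (ν : Fin d) (u : Tor (fine N M) × Fin d → ℂ) {B : ℝ}
    (h : ∀ j, ‖(fdiff (fine N M) (N : ℂ) ν *ᵥ (fdiff (fine N M) (N : ℂ) ν *ᵥ u)) j‖ ≤ B) (i : Tor (fine (R * N) M) × Fin d) :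
    ‖PsiF N R M ν u i‖ ≤ (((R : ℝ) - 1) / ((R : ℝ) * N)) * B := by
  unfold PsiF
  rw [norm_mul]
  exact mul_le_mul (norm_piF_le N R M ν i.1) (norm_fdiffH_fdiff_le N ν u h _) (norm_nonneg _) (ratio_nonneg N R)

/-- `|phiF ν u| ≤ ((R−1)∕(RN))·sup|∇_νu|`. [folklore] -/
theorem norm_phiF_le (ν : Fin d) (u : Tor (fine N M) × Fin d → ℂ) {B : ℝ}
    (h : ∀ j, ‖(fdiff (fine N M) (N : ℂ) ν *ᵥ u) j‖ ≤ B) (z : Tor (fine (R * N) M)) :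
    ‖phiF N R M ν u z‖ ≤ (((R : ℝ) - 1) / ((R : ℝ) * N)) * B := by
  unfold phiF
  rw [norm_mul, stair_mulVec]
  have e : ((sdiff (fine N M) (N : ℂ) ν)ᴴ *ᵥ comp (fine N M) u ν) (par N R M z)
      = ((fdiff (fine N M) (N : ℂ) ν)ᴴ *ᵥ u) (par N R M z, ν) := by
    rw [fdiffH_mulVec_slice]; rfl
  rw [e]
  exact mul_le_mul (norm_piF_le N R M ν z) (norm_fdiffH_le_of_fdiff N ν u h _) (norm_nonneg _) (ratio_nonneg N R)

/-- `|phiLdiv μ u| ≤ ((R−1)∕(RN))·d·sup_{μ′ν′}|∇_{ν′}∇_{μ′}u|`. [folklore] -/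
theorem norm_phiLdiv_le (μ : Fin d) (u : Tor (fine N M) × Fin d → ℂ) {B : ℝ}
    (h : ∀ μ' ν' j, ‖(fdiff (fine N M) (N : ℂ) ν' *ᵥ (fdiff (fine N M) (N : ℂ) μ' *ᵥ u)) j‖ ≤ B) (z : Tor (fine (R * N) M)) :
    ‖phiLdiv N R M μ u z‖ ≤ (((R : ℝ) - 1) / ((R : ℝ) * N)) * (d * B) := by
  unfold phiLdiv
  rw [norm_mul, stair_mulVec]
  refine mul_le_mul (norm_piL_le N R M μ z) ?_ (norm_nonneg _) (ratio_nonneg N R)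
  -- `∂_μ(∂ᴴu) = Σ_ν ∂_μ∂_νᴴu_ν = Σ_ν (∇_μ∇_νᴴu)(·, ν)`
  have e : (sdiff (fine N M) (N : ℂ) μ *ᵥ ((GradOp (fine N M) (N : ℂ))ᴴ *ᵥ u)) (par N R M z)
      = ∑ ν, (fdiff (fine N M) (N : ℂ) μ *ᵥ ((fdiff (fine N M) (N : ℂ) ν)ᴴ *ᵥ u)) (par N R M z, ν) := by
    have hfun : (GradOp (fine N M) (N : ℂ))ᴴ *ᵥ u = ∑ ν, (sdiff (fine N M) (N : ℂ) ν)ᴴ *ᵥ comp (fine N M) u ν := by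
      funext y; rw [GradOp_conjTranspose_mulVec, divS]
    rw [hfun, Matrix.mulVec_sum, Finset.sum_apply]
    refine Finset.sum_congr rfl fun ν _ => ?_
    rw [fdiff_mulVec_slice]
    congr 1
    funext y
    rw [fdiffH_mulVec_slice]
    rfl
  rw [e]
  calc ‖∑ ν, (fdiff (fine N M) (N : ℂ) μ *ᵥ ((fdiff (fine N M) (N : ℂ) ν)ᴴ *ᵥ u)) (par N R M z, ν)‖
      ≤ ∑ ν, ‖(fdiff (fine N M) (N : ℂ) μ *ᵥ ((fdiff (fine N M) (N : ℂ) ν)ᴴ *ᵥ u)) (par N R M z, ν)‖ := norm_sum_le _ _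
    _ ≤ ∑ _ν : Fin d, B := Finset.sum_le_sum fun ν _ => norm_fdiff_fdiffH_le N μ ν u (h μ ν) _
    _ = d * B := by rw [Finset.sum_const, Finset.card_univ, Fintype.card_fin, nsmul_eq_mul]

end TwoLevel

end Summit.QuantumFields.BalabanUV.Beta.GAN24.AveragedPropagatorDefectFields

end
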